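import Literature.Geometry.Kaehler.HolomorphicLineBundleCechRestrictionSeq
import HarnessLib

/-!
# Regular flags of holomorphic functions and covers adapted to them

Layer `Literature/Geometry/Kaehler`. The geometric input of Serre's dimension count (J.-P. Serre,
*Géométrie algébrique et géométrie analytique* (1956), n° 16 Lemme 8; *Faisceaux algébriques
cohérents* (1955), n° 81) in the tree's concrete format: a **regular flag** of `n` local holomorphic
functions `u₀, …, u_{n-1}` on a complex `n`-fold `M` (`RegularFlag`: in charts `O_a`, with zero sets
independent of the chart and, at every common zero of `u₀, …, u_{k-1}`, jointly onto differentials —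
the shape delivered by `Literature.AlgebraicGeometry.HodgeTheory.exists_transverse_flag`), its levels
`Z_k = {u₀ = ⋯ = u_{k-1} = 0}` as regular equations (`RegularFlag.eqns`, prefixes of each other,
`RegularFlag.isPrefix`), and the existence of arbitrarily fine open sets **adapted to the flag**
(`RegularFlag.exists_adapted_nhds`, `RegularFlag.exists_adapted`): every point `c` has a basis of open
neighbourhoods `V` (sup-norm balls in a holomorphic straightening of the deepest level through `c`)
such that for EVERY consecutive pair of levels `Z_{k'+1} ⊆ Z_{k'}`, every holomorphic function on
`Z_{k'+1} ∩ V` extends to a holomorphic function on `Z_{k'} ∩ V` (`RegularFlag.IsAdapted`: compose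
with the holomorphic retraction zeroing the `(k'+1)`-st straightened coordinate, which preserves the
ball; pairs deeper than `c` do not meet `V`). Consequence for the restriction step of the Čech
complexes (`RestrictionStep`, file `HolomorphicLineBundleCechRestrictionSeq`): for a framed cover by
adapted sets the restriction `res : C⁰(𝔙 ∩ Z', L₁) → C⁰(𝔙 ∩ Z, L₁)` is onto
(`RestrictionStep.surjective_res_zero_of_isAdapted`), the degree-`0` surjectivity that makes the
six-term inequality `RestrictionStep.finrank_six_term_le` available.

Also: the differential of a map into `ι → ℂ` is the family of the differentials of its components
(`hasMFDerivAt_pi_space`, `mfderiv_pi_space`), converting the joint surjectivity of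
`exists_transverse_flag` into the form of `RegularEquations`.

## References

* J.-P. Serre, *Géométrie algébrique et géométrie analytique*, Ann. Inst. Fourier 6 (1956), n° 16
  Lemme 8. [SerreGAGA1956]
* J.-P. Serre, *Faisceaux algébriques cohérents*, Ann. of Math. 61 (1955), n° 81. [SerreFAC1955]
* P. Griffiths, J. Harris, *Principles of Algebraic Geometry* (1978), Ch. 0 §2 pp. 18–20.
  [GriffithsHarris1978]
-/

noncomputable section

open scoped Manifold ContDiff Topology
open Set Filter Function Module

namespace Literature.Geometry.Kaehler

variable {E : Type*} [NormedAddCommGroup E] [NormedSpace ℂ E]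
  {M : Type*} [TopologicalSpace M] [ChartedSpace E M]
  {α : Type*} {n : ℕ}

/-! ### The differential of a map into `ι → ℂ` -/

section PiSpace

variable {ι' : Type*} [Fintype ι'] {u : ι' → M → ℂ} {x : M}

/-- The differential of `y ↦ (u_i y)_i` is the family of the differentials of the `u_i`.
[folklore] -/
theorem hasMFDerivAt_pi_space {f' : ι' → (TangentSpace 𝓘(ℂ, E) x →L[ℂ] ℂ)}
    (hu : ∀ i, HasMFDerivAt 𝓘(ℂ, E) 𝓘(ℂ, ℂ) (u i) x (f' i)) :
    HasMFDerivAt 𝓘(ℂ, E) 𝓘(ℂ, ι' → ℂ) (fun y i ↦ u i y) x (ContinuousLinearMap.pi f') := by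
  refine ⟨continuousAt_pi.2 fun i ↦ (hu i).1, ?_⟩
  have key : ∀ i, HasFDerivWithinAt (writtenInExtChartAt 𝓘(ℂ, E) 𝓘(ℂ, ℂ) x (u i)) (f' i)
      (range 𝓘(ℂ, E)) (extChartAt 𝓘(ℂ, E) x x) := fun i ↦ (hu i).2
  exact hasFDerivWithinAt_pi.2 key

/-- **`d(u_i)_i = (du_i)_i`**: the `mfderiv` of a map into `ι → ℂ` with differentiable components.
[folklore] -/
theorem mfderiv_pi_space (hu : ∀ i, MDifferentiableAt 𝓘(ℂ, E) 𝓘(ℂ, ℂ) (u i) x) :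
    mfderiv 𝓘(ℂ, E) 𝓘(ℂ, ι' → ℂ) (fun y i ↦ u i y) x =
      ContinuousLinearMap.pi fun i ↦ mfderiv 𝓘(ℂ, E) 𝓘(ℂ, ℂ) (u i) x :=
  (hasMFDerivAt_pi_space fun i ↦ (hu i).hasMFDerivAt).mfderiv

/-- A map into `ι → ℂ` with differentiable components is differentiable. [folklore] -/
theorem mdifferentiableAt_pi_space (hu : ∀ i, MDifferentiableAt 𝓘(ℂ, E) 𝓘(ℂ, ℂ) (u i) x) :
    MDifferentiableAt 𝓘(ℂ, E) 𝓘(ℂ, ι' → ℂ) (fun y i ↦ u i y) x :=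
  (hasMFDerivAt_pi_space fun i ↦ (hu i).hasMFDerivAt).mdifferentiableAt

end PiSpace

/-! ### Regular flags -/

variable (E M) in
/-- **A regular flag of `n` local holomorphic functions** on `M`: opens `O_a` covering `M` and
functions `u_{i,a} : O_a → ℂ` (`i < n`), holomorphic, with zero sets `{u_{i,a} = 0}` independent of
`a` on overlaps (the `u_{i,a}` are the coordinates of `n` sections of a line bundle in its frames),
such that for every `k ≤ n`, at every common zero of `u_{0,a}, …, u_{k-1,a}` their differentials are
jointly onto `ℂᵏ` — the transverse flag of hyperplane sections of Serre's induction, in the form of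
`Literature.AlgebraicGeometry.HodgeTheory.exists_transverse_flag`.
[cite: SerreGAGA1956, n° 16 Lemme 8] [cite: GriffithsHarris1978, Ch. 0 §2 pp. 18–20] -/
structure RegularFlag (α : Type*) (n : ℕ) where
  /-- the open sets carrying the local functions -/
  O : α → Set M
  /-- they are open -/
  isOpen_O : ∀ a, IsOpen (O a)
  /-- they cover `M` -/
  cover : ∀ x, ∃ a, x ∈ O a
  /-- the flag functions in the chart `a` -/
  u : Fin n → α → M → ℂ
  /-- they are holomorphic -/
  mdifferentiableOn_u : ∀ i a, MDifferentiableOn 𝓘(ℂ, E) 𝓘(ℂ, ℂ) (u i a) (O a)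
  /-- their zero sets do not depend on the chart -/
  zero_iff : ∀ i a b x, x ∈ O a → x ∈ O b → (u i a x = 0 ↔ u i b x = 0)
  /-- transversality along the flag: jointly onto differentials at the common zeroes -/
  surjective_pi : ∀ (k : ℕ) (hk : k ≤ n) (a : α) (x : M), x ∈ O a →
    (∀ i : Fin k, u (Fin.castLE hk i) a x = 0) →
      Surjective (ContinuousLinearMap.pi fun i : Fin k ↦
        mfderiv 𝓘(ℂ, E) 𝓘(ℂ, ℂ) (u (Fin.castLE hk i) a) x)

namespace RegularFlag

variable (Fl : RegularFlag E M α n)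

/-- **The level `k` of the flag as regular equations**: `F_a = (u_{0,a}, …, u_{k-1,a})`.
[cite: SerreGAGA1956, n° 16 Lemme 8] -/
def eqns (k : ℕ) (hk : k ≤ n) : RegularEquations E M α k where
  O := Fl.O
  isOpen_O := Fl.isOpen_O
  cover := Fl.cover
  F a x i := Fl.u (Fin.castLE hk i) a x
  mdifferentiableOn_F a x hx :=
    (mdifferentiableAt_pi_space fun i ↦
      ((Fl.mdifferentiableOn_u (Fin.castLE hk i) a).mdifferentiableAt
        ((Fl.isOpen_O a).mem_nhds hx))).mdifferentiableWithinAt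
  zero_iff a b x ha hb := by
    simp only [funext_iff, Pi.zero_apply]
    exact forall_congr' fun i ↦ Fl.zero_iff _ a b x ha hb
  surjective_mfderiv a x ha hx := by
    rw [mfderiv_pi_space fun i ↦ (Fl.mdifferentiableOn_u (Fin.castLE hk i) a).mdifferentiableAt
      ((Fl.isOpen_O a).mem_nhds ha)]
    exact Fl.surjective_pi k hk a x ha fun i ↦ congr_fun hx i

/-- The opens of a level (definitional). [folklore] -/
@[simp] theorem eqns_O (k : ℕ) (hk : k ≤ n) (a : α) : (Fl.eqns k hk).O a = Fl.O a := rfl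

/-- The equations of a level (definitional). [folklore] -/
@[simp] theorem eqns_F (k : ℕ) (hk : k ≤ n) (a : α) (x : M) (i : Fin k) :
    (Fl.eqns k hk).F a x i = Fl.u (Fin.castLE hk i) a x := rfl

/-- **The levels are prefixes of each other.** [cite: SerreGAGA1956, n° 16 Lemme 8] -/
theorem isPrefix {k k' : ℕ} (hk' : k' ≤ k) (hk : k ≤ n) :
    (Fl.eqns k' (hk'.trans hk)).IsPrefix (Fl.eqns k hk) hk' :=
  ⟨fun _ ↦ rfl, fun _ _ _ ↦ rfl⟩

/-- The loci of the levels decrease. [folklore] -/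
theorem locus_anti {k k' : ℕ} (hk' : k' ≤ k) (hk : k ≤ n) :
    (Fl.eqns k hk).locus ⊆ (Fl.eqns k' (hk'.trans hk)).locus :=
  (Fl.isPrefix hk' hk).locus_subset

/-- Level `0` is everything. [folklore] -/
theorem mem_locus_zero (x : M) : x ∈ (Fl.eqns 0 (Nat.zero_le n)).locus := by
  obtain ⟨a, ha⟩ := Fl.cover x
  exact ⟨a, ha, funext fun i ↦ i.elim0⟩

/-! ### The depth of a point -/

/-- The locus of level `k`, empty beyond `n`. [folklore] -/
def locusN (k : ℕ) : Set M :=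
  {x | ∃ hk : k ≤ n, x ∈ (Fl.eqns k hk).locus}

/-- Membership in `locusN` within range. [folklore] -/
theorem mem_locusN_iff {k : ℕ} (hk : k ≤ n) {x : M} : x ∈ Fl.locusN k ↔ x ∈ (Fl.eqns k hk).locus :=
  ⟨fun ⟨_, h⟩ ↦ h, fun h ↦ ⟨hk, h⟩⟩

/-- `locusN` is closed. [folklore] -/
theorem isClosed_locusN (k : ℕ) : IsClosed (Fl.locusN k) := by
  by_cases hk : k ≤ n
  · convert (Fl.eqns k hk).isClosed_locus using 1
    exact Set.ext fun x ↦ Fl.mem_locusN_iff hk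
  · convert isClosed_empty (X := M) using 1
    exact Set.eq_empty_iff_forall_notMem.2 fun x ⟨hk', _⟩ ↦ hk hk'

/-- `locusN` decreases. [folklore] -/
theorem locusN_anti {k k' : ℕ} (hk' : k' ≤ k) : Fl.locusN k ⊆ Fl.locusN k' :=
  fun _ ⟨hk, h⟩ ↦ ⟨hk'.trans hk, Fl.locus_anti hk' hk h⟩

open scoped Classical in
/-- **The depth of a point**: the largest `k ≤ n` with `x ∈ Z_k`. [folklore] -/
def depth (x : M) : ℕ :=
  Nat.findGreatest (fun k ↦ x ∈ Fl.locusN k) n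

/-- The depth is at most `n`. [folklore] -/
theorem depth_le (x : M) : Fl.depth x ≤ n := by
  classical
  exact Nat.findGreatest_le n

/-- A point lies in the locus of its depth. [folklore] -/
theorem mem_locusN_depth (x : M) : x ∈ Fl.locusN (Fl.depth x) := by
  classical
  exact Nat.findGreatest_spec (P := fun k ↦ x ∈ Fl.locusN k) (Nat.zero_le n)
    ⟨Nat.zero_le n, Fl.mem_locus_zero x⟩

/-- A point does not lie in loci deeper than its depth. [folklore] -/
theorem notMem_locusN_of_depth_lt (x : M) {k : ℕ} (hk : Fl.depth x < k) : x ∉ Fl.locusN k := by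
  classical
  by_cases hkn : k ≤ n
  · exact Nat.findGreatest_is_greatest hk hkn
  · rintro ⟨hk', _⟩
    exact hkn hk'

/-! ### Sets adapted to the flag -/

section Adapted

variable [FiniteDimensional ℂ E] [IsManifold 𝓘(ℂ, E) ω M]

/-- **An open set adapted to the flag**: for every consecutive pair of levels
`Z_{k'+1} ⊆ Z_{k'}` (and every bookkeeping of dimensions), every holomorphic function on `Z_{k'+1} ∩ V`
is the restriction of a holomorphic function on `Z_{k'} ∩ V`. [cite: SerreFAC1955, n° 81] -/
structure IsAdapted (V : Set M) : Prop where
  /-- holomorphic functions on `Z_{k'+1} ∩ V` extend to `Z_{k'} ∩ V` -/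
  extend : ∀ (k' : ℕ) (hk : k' + 1 ≤ n) (d d' : ℕ) (hd : finrank ℂ E = (k' + 1) + d)
    (hd' : finrank ℂ E = k' + d') (w : ((Fl.eqns (k' + 1) hk).atlas hd).Carrier → ℂ),
    MDifferentiableOn 𝓘(ℂ, Fin d → ℂ) 𝓘(ℂ, ℂ) w (((Fl.eqns (k' + 1) hk).atlas hd).val ⁻¹' V) →
    ∃ g : ((Fl.eqns k' ((Nat.le_succ k').trans hk)).atlas hd').Carrier → ℂ,
      MDifferentiableOn 𝓘(ℂ, Fin d' → ℂ) 𝓘(ℂ, ℂ) g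
        (((Fl.eqns k' ((Nat.le_succ k').trans hk)).atlas hd').val ⁻¹' V) ∧
      ∀ x, ((Fl.eqns (k' + 1) hk).atlas hd).val x ∈ V →
        g ((Fl.isPrefix (Nat.le_succ k') hk).incl hd hd' x) = w x

/-- **The coordinate retraction**: zero the coordinate `k'` of the first factor of `ℂ^{k₀} × ℂᵈ`.
[folklore] -/
def zeroCoord (k₀ d₀ k' : ℕ) : ((Fin k₀ → ℂ) × (Fin d₀ → ℂ)) →L[ℂ] ((Fin k₀ → ℂ) × (Fin d₀ → ℂ)) :=
  (ContinuousLinearMap.pi fun i : Fin k₀ ↦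
      if (i : ℕ) = k' then 0 else ContinuousLinearMap.proj i).prodMap
    (ContinuousLinearMap.id ℂ (Fin d₀ → ℂ))

omit [FiniteDimensional ℂ E] [IsManifold 𝓘(ℂ, E) ω M] in
/-- The retraction on the first factor. [folklore] -/
@[simp] theorem zeroCoord_apply_fst {k₀ d₀ k' : ℕ} (v : (Fin k₀ → ℂ) × (Fin d₀ → ℂ)) (i : Fin k₀) :
    (zeroCoord k₀ d₀ k' v).1 i = if (i : ℕ) = k' then 0 else v.1 i := by
  change ((ContinuousLinearMap.pi fun i : Fin k₀ ↦
    if (i : ℕ) = k' then (0 : (Fin k₀ → ℂ) →L[ℂ] ℂ) else ContinuousLinearMap.proj i) v.1) i = _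
  rw [ContinuousLinearMap.pi_apply]
  split_ifs
  · rfl
  · rfl

omit [FiniteDimensional ℂ E] [IsManifold 𝓘(ℂ, E) ω M] in
/-- The retraction is the identity on the second factor. [folklore] -/
@[simp] theorem zeroCoord_apply_snd {k₀ d₀ k' : ℕ} (v : (Fin k₀ → ℂ) × (Fin d₀ → ℂ)) :
    (zeroCoord k₀ d₀ k' v).2 = v.2 := rfl

omit [FiniteDimensional ℂ E] [IsManifold 𝓘(ℂ, E) ω M] in
/-- The retraction fixes the points whose coordinate `k'` vanishes. [folklore] -/
theorem zeroCoord_eq_self {k₀ d₀ k' : ℕ} {v : (Fin k₀ → ℂ) × (Fin d₀ → ℂ)}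
    (hv : ∀ i : Fin k₀, (i : ℕ) = k' → v.1 i = 0) : zeroCoord k₀ d₀ k' v = v := by
  refine Prod.ext (funext fun i ↦ ?_) rfl
  rw [zeroCoord_apply_fst]
  split_ifs with h
  · exact (hv i h).symm
  · rfl

omit [FiniteDimensional ℂ E] [IsManifold 𝓘(ℂ, E) ω M] in
/-- **The retraction does not increase the sup-distance to a point with vanishing first factor**
(so it preserves the sup-norm balls around such a point). [folklore] -/
theorem norm_zeroCoord_sub_le {k₀ d₀ k' : ℕ} (v c : (Fin k₀ → ℂ) × (Fin d₀ → ℂ)) (hc : c.1 = 0) :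
    ‖zeroCoord k₀ d₀ k' v - c‖ ≤ ‖v - c‖ := by
  rw [Prod.norm_def, Prod.norm_def]
  refine max_le_max ?_ (by rw [Prod.snd_sub, Prod.snd_sub, zeroCoord_apply_snd])
  rw [Prod.fst_sub, Prod.fst_sub, hc, sub_zero, sub_zero,
    pi_norm_le_iff_of_nonneg (norm_nonneg _)]
  intro i
  rw [zeroCoord_apply_fst]
  split_ifs
  · rw [norm_zero]; exact norm_nonneg _
  · exact norm_le_pi_norm _ i

omit [FiniteDimensional ℂ E] [IsManifold 𝓘(ℂ, E) ω M] in
/-- The retraction maps sup-norm balls around a point with vanishing first factor into themselves.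
[folklore] -/
theorem zeroCoord_mem_ball {k₀ d₀ k' : ℕ} {v c : (Fin k₀ → ℂ) × (Fin d₀ → ℂ)} (hc : c.1 = 0) {r : ℝ}
    (hv : v ∈ Metric.ball c r) : zeroCoord k₀ d₀ k' v ∈ Metric.ball c r := by
  rw [Metric.mem_ball, dist_eq_norm] at hv ⊢
  exact (norm_zeroCoord_sub_le v c hc).trans_lt hv

/-- **Every point has arbitrarily small open neighbourhoods adapted to the flag**, contained in one
chart of the flag: a sup-norm ball, in a holomorphic straightening of the deepest level `Z_{k₀}`
through the point, missing `Z_{k₀+1}`. For a pair `Z_{k'+1} ⊆ Z_{k'}` with `k' + 1 ≤ k₀` the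
extension is the composite with the holomorphic retraction zeroing the straightened coordinate
`u_{k'}` (which preserves the ball and maps `Z_{k'} ∩ V` onto `Z_{k'+1} ∩ V`); deeper pairs do not meet
`V`. [cite: SerreFAC1955, n° 81] [cite: GriffithsHarris1978, Ch. 0 §2 pp. 18–20] -/
theorem exists_adapted_nhds (hE : finrank ℂ E = n) (c : M) {W : Set M} (hW : IsOpen W) (hcW : c ∈ W) :
    ∃ (V : Set M) (a : α), IsOpen V ∧ c ∈ V ∧ V ⊆ W ∧ V ⊆ Fl.O a ∧ Fl.IsAdapted V := by
  -- the deepest level through `c`, a chart and a straightening there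
  set k₀ := Fl.depth c with hk₀def
  have hk₀ : k₀ ≤ n := Fl.depth_le c
  have hc₀ : c ∈ (Fl.eqns k₀ hk₀).locus := (Fl.mem_locusN_iff hk₀).1 (Fl.mem_locusN_depth c)
  obtain ⟨a, ha, hFa⟩ := hc₀
  have hd₀ : finrank ℂ E = k₀ + (n - k₀) := by omega
  obtain ⟨e, hce, hsub, he, hesymm, hfst⟩ := (Fl.eqns k₀ hk₀).exists_straightening hd₀ ha hFa
  have hec : (e c).1 = 0 := by rw [hfst c hce, hFa]
  -- the open set to stay inside
  set D : Set M := Fl.locusN (k₀ + 1) with hDdef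
  have hcD : c ∉ D := Fl.notMem_locusN_of_depth_lt c (Nat.lt_succ_self _)
  have hT : IsOpen (e.target ∩ e.symm ⁻¹' (W ∩ Dᶜ)) :=
    e.isOpen_inter_preimage_symm (hW.inter (Fl.isClosed_locusN _).isOpen_compl)
  have hcT : e c ∈ e.target ∩ e.symm ⁻¹' (W ∩ Dᶜ) := by
    refine ⟨e.map_source hce, ?_⟩
    rw [mem_preimage, e.left_inv hce]
    exact ⟨hcW, hcD⟩
  obtain ⟨r, hr, hball⟩ := Metric.isOpen_iff.1 hT (e c) hcT
  set V : Set M := e.source ∩ e ⁻¹' Metric.ball (e c) r with hVdef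
  have hVW : ∀ y ∈ V, y ∈ W ∧ y ∉ D := fun y hy ↦ by
    have h := (hball hy.2).2
    rwa [mem_preimage, e.left_inv hy.1] at h
  refine ⟨V, a, e.isOpen_inter_preimage Metric.isOpen_ball, ⟨hce, Metric.mem_ball_self hr⟩,
    fun y hy ↦ (hVW y hy).1, fun y hy ↦ hsub hy.1, ⟨?_⟩⟩
  intro k' hk d d' hd hd' w hw
  by_cases hkk : k' + 1 ≤ k₀
  · -- both levels are straightened by `e`
    have hP : (Fl.eqns (k' + 1) hk).IsPrefix (Fl.eqns k₀ hk₀) hkk := Fl.isPrefix hkk hk₀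
    have hP' : (Fl.eqns k' ((Nat.le_succ k').trans hk)).IsPrefix (Fl.eqns k₀ hk₀)
        ((Nat.le_succ k').trans hkk) := Fl.isPrefix _ hk₀
    have hcQ : c ∈ (Fl.eqns (k' + 1) hk).locus := hP.locus_subset ⟨a, ha, hFa⟩
    let N := (Fl.eqns (k' + 1) hk).atlas hd
    let N' := (Fl.eqns k' ((Nat.le_succ k').trans hk)).atlas hd'
    -- the retraction in the straightening
    let π := zeroCoord k₀ (n - k₀) k'
    -- the target point in `M` of a point of `Z_{k'} ∩ V`
    have hPV : ∀ y : M, y ∈ V → e.symm (π (e y)) ∈ V ∧ e (e.symm (π (e y))) = π (e y) := by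
      intro y hy
      have hπb : π (e y) ∈ Metric.ball (e c) r := zeroCoord_mem_ball hec hy.2
      have hπt : π (e y) ∈ e.target := (hball hπb).1
      exact ⟨⟨e.map_target hπt, by rw [mem_preimage, e.right_inv hπt]; exact hπb⟩, e.right_inv hπt⟩
    have hPZ : ∀ y : M, y ∈ V → y ∈ (Fl.eqns k' ((Nat.le_succ k').trans hk)).locus →
        e.symm (π (e y)) ∈ (Fl.eqns (k' + 1) hk).locus := by
      intro y hy hyZ'
      have hy0 := (hP'.mem_locus_iff_of_straightening hsub hfst hy.1).1 hyZ'
      refine (hP.mem_locus_iff_of_straightening hsub hfst (hPV y hy).1.1).2 fun i ↦ ?_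
      rw [(hPV y hy).2, zeroCoord_apply_fst]
      split_ifs with hi
      · rfl
      · have hi' : (i : ℕ) < k' := by
          have h1 : (i : ℕ) < k' + 1 := i.isLt
          have h2 : ((Fin.castLE hkk i : Fin k₀) : ℕ) = i := Fin.val_castLE hkk i
          omega
        rw [show Fin.castLE hkk i = Fin.castLE ((Nat.le_succ k').trans hkk) ⟨i, hi'⟩ from Fin.ext rfl]
        exact hy0 ⟨i, hi'⟩
    -- the retraction of the manifolds `Z_{k'} ∩ V → Z_{k'+1} ∩ V`
    classical
    let X : N'.Carrier → N.Carrier := fun y ↦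
      if h : N'.val y ∈ V then N.ofSubtype ⟨e.symm (π (e (N'.val y))), hPZ _ h (N'.val_mem y)⟩
      else N.ofSubtype ⟨c, hcQ⟩
    have hXval : ∀ y, N'.val y ∈ V → N.val (X y) = e.symm (π (e (N'.val y))) := fun y hy ↦ by
      simp only [X, dif_pos hy, AmbientHolAtlas.val_ofSubtype]
    have hXV : ∀ y, N'.val y ∈ V → N.val (X y) ∈ V := fun y hy ↦ by
      rw [hXval y hy]; exact (hPV _ hy).1
    have hX : MDifferentiableOn 𝓘(ℂ, Fin d' → ℂ) 𝓘(ℂ, Fin d → ℂ) X (N'.val ⁻¹' V) := by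
      refine N.mdifferentiableOn_of_val_comp ?_
      have h1 : MDifferentiableOn 𝓘(ℂ, Fin d' → ℂ) 𝓘(ℂ, (Fin k₀ → ℂ) × (Fin (n - k₀) → ℂ))
          (e ∘ N'.val) (N'.val ⁻¹' V) :=
        he.comp N'.mdifferentiable_val.mdifferentiableOn fun y hy ↦ hy.1
      have h2 : MDifferentiableOn 𝓘(ℂ, Fin d' → ℂ) 𝓘(ℂ, (Fin k₀ → ℂ) × (Fin (n - k₀) → ℂ))
          (π ∘ (e ∘ N'.val)) (N'.val ⁻¹' V) :=
        π.mdifferentiable.comp_mdifferentiableOn h1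
      have h3 : MDifferentiableOn 𝓘(ℂ, Fin d' → ℂ) 𝓘(ℂ, E)
          (e.symm ∘ (π ∘ (e ∘ N'.val))) (N'.val ⁻¹' V) :=
        hesymm.comp h2 fun y hy ↦ (hball (zeroCoord_mem_ball (k' := k') hec hy.2)).1
      exact h3.congr fun y hy ↦ by simp only [Function.comp_apply, hXval y hy]
    refine ⟨w ∘ X, hw.comp hX fun y hy ↦ hXV y hy, fun x hx ↦ ?_⟩
    -- on `Z_{k'+1} ∩ V` the retraction is the identity
    have hxV : N'.val ((Fl.isPrefix (Nat.le_succ k') hk).incl hd hd' x) ∈ V := hx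
    have hfix : π (e (N.val x)) = e (N.val x) := by
      refine zeroCoord_eq_self fun i hi ↦ ?_
      have h0 := (hP.mem_locus_iff_of_straightening hsub hfst hx.1).1 (N.val_mem x)
        ⟨k', Nat.lt_succ_self k'⟩
      rw [show i = Fin.castLE hkk ⟨k', Nat.lt_succ_self k'⟩ from Fin.ext hi]
      exact h0
    have hval : N.val (X ((Fl.isPrefix (Nat.le_succ k') hk).incl hd hd' x)) = N.val x := by
      rw [hXval _ hxV, RegularEquations.IsPrefix.val_incl, hfix, e.left_inv hx.1]
    change w (X _) = w x
    rw [N.val_injective hval]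
  · -- the pair is deeper than `c`: `Z_{k'+1} ∩ V = ∅`
    have hk₀k : k₀ + 1 ≤ k' + 1 := by omega
    refine ⟨0, mdifferentiableOn_const, fun x hx ↦ ?_⟩
    exfalso
    refine (hVW _ hx).2 (Fl.locusN_anti hk₀k ⟨hk, ?_⟩)
    exact ((Fl.eqns (k' + 1) hk).atlas hd).val_mem x

/-- **A family of adapted open sets through every point**, inside prescribed open neighbourhoods and
inside the charts of the flag. [cite: SerreFAC1955, n° 81] -/
theorem exists_adapted (hE : finrank ℂ E = n) {W : M → Set M} (hWo : ∀ c, IsOpen (W c))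
    (hWc : ∀ c, c ∈ W c) :
    ∃ (V : M → Set M) (a : M → α), (∀ c, IsOpen (V c)) ∧ (∀ c, c ∈ V c) ∧ (∀ c, V c ⊆ W c) ∧
      (∀ c, V c ⊆ Fl.O (a c)) ∧ ∀ c, Fl.IsAdapted (V c) := by
  choose V a h1 h2 h3 h4 h5 using fun c ↦ Fl.exists_adapted_nhds hE c (hWo c) (hWc c)
  exact ⟨V, a, h1, h2, h3, h4, h5⟩

end Adapted

end RegularFlag

/-! ### Degree-zero surjectivity of the restriction along an adapted cover -/

namespace RestrictionStep

open HolomorphicLineBundle HolomorphicLineBundle.FramedCover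

variable [FiniteDimensional ℂ E] [IsManifold 𝓘(ℂ, E) ω M] {Fl : RegularFlag E M α n} {k' d d' : ℕ}
  {hk : k' + 1 ≤ n} {ι κ : Type*}
  (S : RestrictionStep (Fl.eqns k' ((Nat.le_succ k').trans hk)) (Fl.eqns (k' + 1) hk) ι κ)
  (hd : finrank ℂ E = (k' + 1) + d) (hd' : finrank ℂ E = k' + d')

/-- **`res : C⁰(𝔙 ∩ Z', L₁) → C⁰(𝔙 ∩ Z, L₁)` is onto when the members of `𝔙` are adapted to the
flag**: every holomorphic function on `Z ∩ V_k` extends to `Z' ∩ V_k`. [cite: SerreFAC1955, n° 81] -/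
theorem surjective_res_zero_of_isAdapted (hV : ∀ k, Fl.IsAdapted (S.cover.U k)) :
    Surjective (S.res hd hd' 0) := by
  classical
  intro c
  have hw : ∀ J : Fin 1 → κ, MDifferentiableOn 𝓘(ℂ, Fin d → ℂ) 𝓘(ℂ, ℂ)
      ((c J : ((Fl.eqns (k' + 1) hk).atlas hd).Carrier → ℂ))
      (((Fl.eqns (k' + 1) hk).atlas hd).val ⁻¹' S.cover.U (J 0)) := fun J ↦
    (holFunOn.mdifferentiableOn (c J)).mono fun x hx ↦ mem_cechSet_iff.2 fun i ↦ by
      rw [Fin.fin_one_eq_zero i]; exact hx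
  choose g hg hgw using fun J : Fin 1 → κ ↦ (hV (J 0)).extend k' hk d d' hd hd' _ (hw J)
  have hsub : ∀ J : Fin 1 → κ, cechSet (S.coverB hd').U J ⊆
      ((Fl.eqns k' ((Nat.le_succ k').trans hk)).atlas hd').val ⁻¹' S.cover.U (J 0) := fun J y hy ↦
    cechSet_subset_apply (S.coverB hd').U J 0 hy
  have hmem : ∀ J : Fin 1 → κ, (fun y ↦ if y ∈ cechSet (S.coverB hd').U J then g J y else 0) ∈
      holFunOn (Fin d' → ℂ) (cechSet (S.coverB hd').U J) := fun J ↦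
    ⟨((hg J).mono (hsub J)).congr fun y hy ↦ if_pos hy, fun y hy ↦ if_neg hy⟩
  refine ⟨fun J ↦ ⟨_, hmem J⟩, funext fun J ↦ Subtype.ext (funext fun x ↦ ?_)⟩
  rw [S.res_apply_apply]
  change (if S.isPrefix.incl hd hd' x ∈ cechSet (S.coverB hd').U J then
    g J (S.isPrefix.incl hd hd' x) else 0) = _
  by_cases hx : x ∈ cechSet (S.coverC hd).U J
  · rw [if_pos ((S.isComap_BC hd hd').mem_cechSet_iff'.1 hx)]
    exact hgw J x (cechSet_subset_apply (S.coverC hd).U J 0 hx)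
  · rw [if_neg fun h ↦ hx ((S.isComap_BC hd hd').mem_cechSet_iff'.2 h), holFunOn.apply_of_notMem (c J) hx]

end RestrictionStep

end Literature.Geometry.Kaehler
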